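import Summits.BirchSwinnertonDyer.BirchSwinnertonDyer.Theorems.PrintX10bStubAExactAtPAnnSat
import Literature.NumberTheory.EllipticCurves.ZpExtensionEisensteinDVRSettingH4AnnSatOfLiftsMultiplicativeThreeProofs
import HarnessLib

/-!
# The (ANN-SAT) half of (Exact) at the places `v ∣ 3` for a curve with MULTIPLICATIVE reduction at `3` — the twin frame of crux 24737
# (helper, THEOREMS ONLY: no definition, no named fact, no instance, no `sorry`)

Helper toward the registered stub `stub_howardOutputsOfFamily` (K2) of line `beta-road` (skeleton v10 cd44fe9d5c6b9a78) of crux r205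
stmt-BirchSwinnertonDyer-24737 `…Theses.UniversalToricDescent.TwinAlgMuZeroAtThree` (LEAD lineage `bsd-wall-utd-p1`, g25): the first
SUMMITS-side brick of the twin's E2 (H-twin) assembly.  Cell x9/x10b's `HeegnerMuPartH4AtSAnnSat.annSatAtP`
(`Theorems/PrintX10bStubAExactAtPAnnSat`, the (ANN-SAT) half of D1's `Stmt.exactAtP` on the `Thm413Hypotheses` frames: `p ∤ N`, good
ordinary at `p`) restated at `p = 3` on the TWIN frame — `K` imaginary quadratic, `κ` anticyclotomic, `K` Heegner for `N`, and
MULTIPLICATIVE reduction of `W_K` at every place above `3` (for the twin `W′` of the universal-toric-descent route, `3 ∥ N′`, this is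
`UniversalToricDescentTwinTateLineAtThree.hasMultiplicativeReductionAt_baseChange_of_mult_three`) — with the same conclusion (Y)/(X) at every
`v ∈ S` above `3`, for all `m ≥ m₅(S)`.  Proof = x10b's, the frame facts `hyp.ordinary`/`hgoodw`/`hordw` replaced by the multiplicative
(ANN-SAT) theorems `…_ofLifts_of_hasMultiplicativeReductionAt_three'` (p759020).  Bookkeeping toward one stub of one crux; no summit statement
is proved; BSD is not proved by any of this.
-/

set_option linter.dupNamespace false
set_option autoImplicit false

noncomputable section

open scoped Classical Pointwise ContRepresentation TensorProduct NumberField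

open Function NumberField IsDedekindDomain Field
open Literature Literature.NumberTheory.EllipticCurves WeierstrassCurve
open Literature.NumberTheory.GaloisCohomology Literature.NumberTheory.GaloisCohomology.Howard2004
open Literature.NumberTheory.GaloisRepresentations Literature.NumberTheory.GaloisRepresentations.DiscreteGaloisModule
open Literature.NumberTheory.Automorphic
open Literature.NumberTheory.EllipticCurves.ZpExtension (EisensteinLevel)
open Summit.BirchSwinnertonDyer.BirchSwinnertonDyer.Theorems


namespace Summit.BirchSwinnertonDyer.BirchSwinnertonDyer.Theorems.UniversalToricDescentTwinH4AtSAnnSat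

set_option synthInstance.maxHeartbeats 80000 in
set_option maxHeartbeats 1600000 in
/-- **The (ANN-SAT) half of (Exact) at `v ∣ 3` on the twin frame** (multiplicative reduction above `3`, `K` imaginary quadratic Heegner for
`N`, `κ` anticyclotomic): for all `m ≥ m₅(S)`, at every `v ∈ S` above `3`, (Y) every compatible family of `(H¹(K_v, Tw T^{(j)}))_j`
orthogonal at every level to the families saturated for the strict ordinary cores at `v` is saturated for the transported strict ordinary
cores from `σ•v`; (X) the flipped twin.  x10b's `HeegnerMuPartH4AtSAnnSat.annSatAtP` with the good-ordinary frame facts replaced by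
`…H4AnnSatOfLiftsMultiplicativeThreeProofs`. [cite: Howard2004HeegnerKolyvagin, §1.3 H.4, Lemma 3.1.1 and Def. 3.2.6 (arXiv p. 7 L78–82, p. 15–16)]
[cite: MilneADT2006, Ch. I Cor. 2.3 and Thm. 2.6] -/
theorem annSatAtThree_of_hasMultiplicativeReductionAt :
  ∀ (N : ℕ) [NeZero N] (W : WeierstrassCurve ℚ) [W.IsElliptic] (K : Type) [Field K] [NumberField K]
    (κ : ZpExtension K 3),
    IsImaginaryQuadratic K → κ.IsAnticyclotomic → SatisfiesHeegnerHypothesis N K →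
    (∀ w : HeightOneSpectrum (𝓞 K), ((3 : ℕ) : 𝓞 K) ∈ w.asIdeal → (W.baseChange K).HasMultiplicativeReductionAt w) →
    ∀ (S : Finset (HeightOneSpectrum (𝓞 K)))
      (hpS : ∀ v, ((3 : ℕ) : 𝓞 K) ∈ v.asIdeal → v ∈ S)
      (hbad : ∀ v, v ∉ S → ((3 : ℕ) : 𝓞 K) ∉ v.asIdeal → (W.baseChange K).HasGoodReductionAt v),
    (∀ v ∈ S, ((3 : ℕ) : 𝓞 K) ∈ v.asIdeal ∨ ((N : ℕ) : 𝓞 K) ∈ v.asIdeal) →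
    (∀ (σ : K ≃ₐ[ℚ] K) (v : HeightOneSpectrum (𝓞 K)), σ • v ∈ S → v ∈ S) →
    ∃ m₅ : ℕ, ∀ (m : ℕ) (hm : 1 ≤ m), m₅ ≤ m →
      letI := IwasawaAlgebra.isDomain_quotient_X_pow_add_C 3 hm
      letI := IwasawaAlgebra.isDiscreteValuationRing_quotient_X_pow_add_C 3 hm
      haveI := IwasawaAlgebra.EisensteinCoeff.isLocalRing_succ 3 hm
      letI := IwasawaAlgebra.EisensteinCoeff.algebraOfSpecSucc 3 m
      haveI := W.isScalarTower_algebraOfSpecSucc (K := K) (p := 3) (m := m)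
      letI := W.residueModuleSucc (K := K) (p := 3) hm
      ∀ (L : Set (HeightOneSpectrum (𝓞 K)))
        (hL : L ⊆ (W.eisensteinTower (κ.unitTwist (-1)) hm).degreeTwoPrimes 3) (hLS : ∀ v ∈ L, v ∉ S)
        (c₀ : absoluteGaloisGroup ℚ) (σ : K ≃ₐ[ℚ] K) (hσ₁ : σ ≠ 1) (hσ : σ * σ = 1)
        (hτl : IsLiftOfAut σ (absGaloisTransport (K := ℚ) (L := K) c₀).toRingEquiv)
        (hτ₂ : Function.Involutive (absGaloisTransport (K := ℚ) (L := K) c₀).toRingEquiv)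
        (D : ∀ k, DualityDatum 3 (ConjugationDatum.ofLifts σ hσ₁ hσ _ hτl hτ₂)
          ((W.eisensteinTower (κ.unitTwist (-1)) hm).ρ k) (IwasawaAlgebra.EisensteinCoeff 3 m (k + 1)))
        (e : ∀ j : ℕ, geomTorsion (W.baseChange K) (((3 : ℕ) : ℤ) ^ j) →+ geomTorsion (W.baseChange K) (((3 : ℕ) : ℤ) ^ j) →+
          MuCarrier K (3 ^ j))
        (log : ∀ j : ℕ, MuCarrier K (3 ^ j) →+ ZMod (3 ^ j)),
        IsComplexConjugation (Rat.castHom ℝ) c₀ →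
        (∀ x, (ConjugationDatum.ofLifts σ hσ₁ hσ _ hτl hτ₂).τ x = absGaloisTransport (K := ℚ) (L := K) c₀ x) →
        (∀ k, (D k).e = ZpExtension.eisensteinDualityForm hm (k + 1)
          (conjPairing (e (k + 1)) ((ConjugationDatum.ofLifts σ hσ₁ hσ _ hτl hτ₂).isLift.torsionMap W _)
            (log (k + 1)))) →
        (∀ k (x y : EisensteinLevel 3 m (fun j ↦ geomTorsion (W.baseChange K) (((3 : ℕ) : ℤ) ^ j)) (k + 1 + 1)),
          IwasawaAlgebra.EisensteinCoeff.reduce 3 m (Nat.le_succ (k + 1)) ((D (k + 1)).e x y) =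
            (D k).e ((W.eisensteinTower (κ.unitTwist (-1)) hm).red k x) ((W.eisensteinTower (κ.unitTwist (-1)) hm).red k y)) →
        (∀ j a, e j a a = 0) →
        (∀ j (g : absoluteGaloisGroup K) a b, e j (g • a) (g • b) = mu K (3 ^ j) g (e j a b)) →
        (∀ j a b, e j ((ConjugationDatum.ofLifts σ hσ₁ hσ _ hτl hτ₂).isLift.torsionMap W _ a)
          ((ConjugationDatum.ofLifts σ hσ₁ hσ _ hτl hτ₂).isLift.torsionMap W _ b) = -e j a b) →
        (∀ j (a : geomTorsion (W.baseChange K) (((3 : ℕ) : ℤ) ^ j)),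
          (ConjugationDatum.ofLifts σ hσ₁ hσ _ hτl hτ₂).isLift.torsionMap W _
            ((ConjugationDatum.ofLifts σ hσ₁ hσ _ hτl hτ₂).isLift.torsionMap W _ a) = a) →
        (∀ j, Function.Bijective (log j)) →
        (∀ j (g : absoluteGaloisGroup K) ξ, log j (mu K (3 ^ j) g ξ) = cyclotomicCharacterModPow K 3 j g * log j ξ) →
        ∀ (v : HeightOneSpectrum (𝓞 K)), v ∈ S → ((3 : ℕ) : 𝓞 K) ∈ v.asIdeal →
          (∀ ζ ∈ Tower.compatibleFamilies (H := fun j ↦ galoisCohomology (((ConjugationDatum.ofLifts σ hσ₁ hσ _ hτl hτ₂).twist ((W.eisensteinTower (κ.unitTwist (-1)) hm).ρ j)).toLocal (Sum.inr v)) 1)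
              (fun j ↦ ContinuousRep.cohomologyMap (((ConjugationDatum.ofLifts σ hσ₁ hσ _ hτl hτ₂).twist ((W.eisensteinTower (κ.unitTwist (-1)) hm).ρ (j + 1))).toLocal (Sum.inr v))
            (((ConjugationDatum.ofLifts σ hσ₁ hσ _ hτl hτ₂).twist ((W.eisensteinTower (κ.unitTwist (-1)) hm).ρ j)).toLocal (Sum.inr v)) ((W.eisensteinTower (κ.unitTwist (-1)) hm).red j).toAddMonoidHom
            continuous_of_discreteTopology (fun _ z => (W.eisensteinTower (κ.unitTwist (-1)) hm).red_equivariant j _ z) 1),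
            (∀ (j : ℕ), ∀ ξ ∈ Tower.saturatedFamilies (H := fun j ↦ galoisCohomology (((W.eisensteinTower (κ.unitTwist (-1)) hm).ρ j).toLocal (Sum.inr v)) 1)
                (fun j ↦ ContinuousRep.cohomologyMap (((W.eisensteinTower (κ.unitTwist (-1)) hm).ρ (j + 1)).toLocal (Sum.inr v))
            (((W.eisensteinTower (κ.unitTwist (-1)) hm).ρ j).toLocal (Sum.inr v)) ((W.eisensteinTower (κ.unitTwist (-1)) hm).red j).toAddMonoidHom
            continuous_of_discreteTopology (fun _ z => (W.eisensteinTower (κ.unitTwist (-1)) hm).red_equivariant j _ z) 1) 3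
                (fun j ↦ ((W.baseChange K).ordinaryFiltrationAt v (fun j ↦ (W.baseChange K).torsionGaloisModuleReduce 3 j) (fun _ _ ↦ rfl)).ordinaryCore hm (j + 1)),
              (D j).localCup (Sum.inr v) (ξ j) (ζ j) = 0) →
            ζ ∈ Tower.saturatedFamilies (H := fun j ↦ galoisCohomology (((ConjugationDatum.ofLifts σ hσ₁ hσ _ hτl hτ₂).twist ((W.eisensteinTower (κ.unitTwist (-1)) hm).ρ j)).toLocal (Sum.inr v)) 1)
                (fun j ↦ ContinuousRep.cohomologyMap (((ConjugationDatum.ofLifts σ hσ₁ hσ _ hτl hτ₂).twist ((W.eisensteinTower (κ.unitTwist (-1)) hm).ρ (j + 1))).toLocal (Sum.inr v))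
            (((ConjugationDatum.ofLifts σ hσ₁ hσ _ hτl hτ₂).twist ((W.eisensteinTower (κ.unitTwist (-1)) hm).ρ j)).toLocal (Sum.inr v)) ((W.eisensteinTower (κ.unitTwist (-1)) hm).red j).toAddMonoidHom
            continuous_of_discreteTopology (fun _ z => (W.eisensteinTower (κ.unitTwist (-1)) hm).red_equivariant j _ z) 1) 3
                (fun j ↦ (((W.baseChange K).ordinaryFiltrationAt ((ConjugationDatum.ofLifts σ hσ₁ hσ _ hτl hτ₂).σ • v) (fun j ↦ (W.baseChange K).torsionGaloisModuleReduce 3 j) (fun _ _ ↦ rfl)).ordinaryCore hm (j + 1)).map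
            ((ConjugationDatum.ofLifts σ hσ₁ hσ _ hτl hτ₂).transportH1 ((κ.unitTwist (-1)).eisensteinTwist ((W.baseChange K).torsionGaloisModule (((3 : ℕ) : ℤ) ^ (j + 1))) hm (j + 1)) v))) ∧
          (∀ ζ ∈ Tower.compatibleFamilies (H := fun j ↦ galoisCohomology (((W.eisensteinTower (κ.unitTwist (-1)) hm).ρ j).toLocal (Sum.inr v)) 1)
              (fun j ↦ ContinuousRep.cohomologyMap (((W.eisensteinTower (κ.unitTwist (-1)) hm).ρ (j + 1)).toLocal (Sum.inr v))
            (((W.eisensteinTower (κ.unitTwist (-1)) hm).ρ j).toLocal (Sum.inr v)) ((W.eisensteinTower (κ.unitTwist (-1)) hm).red j).toAddMonoidHom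
            continuous_of_discreteTopology (fun _ z => (W.eisensteinTower (κ.unitTwist (-1)) hm).red_equivariant j _ z) 1),
            (∀ (j : ℕ), ∀ η ∈ Tower.saturatedFamilies (H := fun j ↦ galoisCohomology (((ConjugationDatum.ofLifts σ hσ₁ hσ _ hτl hτ₂).twist ((W.eisensteinTower (κ.unitTwist (-1)) hm).ρ j)).toLocal (Sum.inr v)) 1)
                (fun j ↦ ContinuousRep.cohomologyMap (((ConjugationDatum.ofLifts σ hσ₁ hσ _ hτl hτ₂).twist ((W.eisensteinTower (κ.unitTwist (-1)) hm).ρ (j + 1))).toLocal (Sum.inr v))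
            (((ConjugationDatum.ofLifts σ hσ₁ hσ _ hτl hτ₂).twist ((W.eisensteinTower (κ.unitTwist (-1)) hm).ρ j)).toLocal (Sum.inr v)) ((W.eisensteinTower (κ.unitTwist (-1)) hm).red j).toAddMonoidHom
            continuous_of_discreteTopology (fun _ z => (W.eisensteinTower (κ.unitTwist (-1)) hm).red_equivariant j _ z) 1) 3
                (fun j ↦ (((W.baseChange K).ordinaryFiltrationAt ((ConjugationDatum.ofLifts σ hσ₁ hσ _ hτl hτ₂).σ • v) (fun j ↦ (W.baseChange K).torsionGaloisModuleReduce 3 j) (fun _ _ ↦ rfl)).ordinaryCore hm (j + 1)).map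
            ((ConjugationDatum.ofLifts σ hσ₁ hσ _ hτl hτ₂).transportH1 ((κ.unitTwist (-1)).eisensteinTwist ((W.baseChange K).torsionGaloisModule (((3 : ℕ) : ℤ) ^ (j + 1))) hm (j + 1)) v)),
              (D j).localCup (Sum.inr v) (ζ j) (η j) = 0) →
            ζ ∈ Tower.saturatedFamilies (H := fun j ↦ galoisCohomology (((W.eisensteinTower (κ.unitTwist (-1)) hm).ρ j).toLocal (Sum.inr v)) 1)
                (fun j ↦ ContinuousRep.cohomologyMap (((W.eisensteinTower (κ.unitTwist (-1)) hm).ρ (j + 1)).toLocal (Sum.inr v))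
            (((W.eisensteinTower (κ.unitTwist (-1)) hm).ρ j).toLocal (Sum.inr v)) ((W.eisensteinTower (κ.unitTwist (-1)) hm).red j).toAddMonoidHom
            continuous_of_discreteTopology (fun _ z => (W.eisensteinTower (κ.unitTwist (-1)) hm).red_equivariant j _ z) 1) 3
                (fun j ↦ ((W.baseChange K).ordinaryFiltrationAt v (fun j ↦ (W.baseChange K).torsionGaloisModuleReduce 3 j) (fun _ _ ↦ rfl)).ordinaryCore hm (j + 1))) := by
  intro N _ W _ K _ _ κ hK hanti₀ hHeeg hmultw S hpS hbad hSN hSσ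
  classical
  haveI : IsTotallyComplex K := hK.isTotallyComplex
  have himag : ∀ w : NumberField.InfinitePlace K, w.IsComplex := fun w ↦ IsTotallyComplex.isComplex w
  have hanti : (κ.unitTwist (-1)).IsAnticyclotomic := hanti₀.unitTwist (-1)
  have hN0 : N ≠ 0 := NeZero.ne N
  have hdec : ∀ v ∈ S, ¬ (GreenbergSelmer.decomp v ≤ (κ.unitTwist (-1)).kerSubgroup) :=
    fun v hv ↦ ZpExtension.decomp_not_le_kerSubgroup_of_mem_or_mem hK (κ.unitTwist (-1)) hanti hHeeg hN0 hSN v hv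
  -- (B4) §4: at every `v ∈ S` an element `g₀ ∈ Γ_{K_v}` with `κ⁻(g₀) = p^{s_v}` exactly
  have hsg : ∀ v ∈ S, ∃ (s : ℕ) (g₀ : absoluteGaloisGroup (v.adicCompletion K)),
      ((κ.unitTwist (-1)) (absGaloisRestrict K (v.adicCompletion K) g₀)).toAdd = ((3 ^ s : ℕ) : ℤ_[3]) :=
    fun v hv ↦ (κ.unitTwist (-1)).exists_toAdd_apply_absGaloisRestrict_eq_pow_of_not_decomp_le v (hdec v hv)
  choose! sv g₀ hg₀ using hsg
  refine ⟨S.sup (fun v ↦ 2 * 3 ^ sv v) + 1, fun m hm hle L hL hLS c₀ σ hσ₁ hσ hτl hτ₂ D e log hc₀ hτ hDe he_red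
    h4' h5' h6' h7' h8' h9' v hvS hpv ↦ ?_⟩
  have hms : 2 * 3 ^ sv v < m :=
    lt_of_le_of_lt (Finset.le_sup (f := fun v ↦ 2 * 3 ^ sv v) hvS) (Nat.lt_of_lt_of_le (Nat.lt_succ_self _) hle)
  letI := IwasawaAlgebra.isDomain_quotient_X_pow_add_C 3 hm
  letI := IwasawaAlgebra.isDiscreteValuationRing_quotient_X_pow_add_C 3 hm
  haveI := IwasawaAlgebra.EisensteinCoeff.isLocalRing_succ 3 hm
  letI := IwasawaAlgebra.EisensteinCoeff.algebraOfSpecSucc 3 m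
  haveI := W.isScalarTower_algebraOfSpecSucc (K := K) (p := 3) (m := m)
  letI := W.residueModuleSucc (K := K) (p := 3) hm
  haveI := charZero_adicCompletion v
  -- the frame facts at the two places `v`, `σ•v` above `p`
  have hσpv : ((3 : ℕ) : 𝓞 K) ∈ ((ConjugationDatum.ofLifts σ hσ₁ hσ _ hτl hτ₂).σ • v).asIdeal :=
    (WeierstrassCurve.natCast_mem_smul_asIdeal_iff (K := K) (p := 3) σ v).2 hpv
  -- the conjugated element for the twisted side (anticyclotomic sign)
  have hg₁ := ZpExtension.toAdd_apply_conj_absGaloisRestrict_inv_eq_of_anticyclotomic (κ.unitTwist (-1))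
    (ConjugationDatum.ofLifts σ hσ₁ hσ _ hτl hτ₂)
    (fun g ↦ ZpExtension.toAdd_conjGalCMH_eq_neg (κ.unitTwist (-1)) hanti himag hτl hc₀ hτ g) v (hg₀ v hvS)
  refine ⟨fun ζ hζ h0 ↦ ?_, fun ξ hξ h0 ↦ ?_⟩
  · exact W.eisensteinTower_mem_saturatedFamilies_of_forall_localCup_eq_zero_ofLifts_of_hasMultiplicativeReductionAt_three' (κ.unitTwist (-1)) hm
      σ hσ₁ hσ _ hτl hτ₂ D he_red (hmultw v hpv) hpv (hmultw _ hσpv) hσpv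
      (fun k ↦ e (k + 1)) (fun k ↦ log (k + 1)) hDe (fun k ↦ h4' (k + 1)) (fun k ↦ h7' (k + 1)) (fun k ↦ h8' (k + 1))
      (fun k ↦ h9' (k + 1)) hg₁ hms hζ h0
  · exact W.eisensteinTower_mem_saturatedFamilies_of_forall_localCup_flip_eq_zero_ofLifts_of_hasMultiplicativeReductionAt_three' (κ.unitTwist (-1)) hm
      σ hσ₁ hσ _ hτl hτ₂ D he_red (hmultw v hpv) hpv (hmultw _ hσpv) hσpv
      (fun k ↦ e (k + 1)) (fun k ↦ log (k + 1)) hDe (fun k ↦ h4' (k + 1)) (fun k ↦ h7' (k + 1)) (fun k ↦ h8' (k + 1))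
      (fun k ↦ h9' (k + 1)) (hg₀ v hvS) hms hξ h0

end Summit.BirchSwinnertonDyer.BirchSwinnertonDyer.Theorems.UniversalToricDescentTwinH4AtSAnnSat

end
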